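import Literature.AlgebraicGeometry.AbelianSchemes.AbelianSchemeAffineBase
import Literature.AlgebraicGeometry.Limits.SurjectiveSpread
import HarnessLib

/-!
# Surjectivity onto an abelian scheme spreads from a generising base change (F4′: the hypotheses of
# `Limits.surjective_left_of_surjective_pullback_map_left` discharged for abelian schemes)

Topic `Literature/AlgebraicGeometry/AbelianSchemes`; namespace `Literature.AlgebraicGeometry.AbelianSchemes`.  KERNEL ONLY:
theorems; no definition, no named fact, no `sorry`.  Sequel of `Limits/SurjectiveSpread.lean` (F4 of the III-0 road,
A-p14's SPEC §F4) in the `AbelianScheme` currency of `AbelianSchemeAffineBase.lean`: the structure morphism of an abelian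
scheme is smooth, hence FLAT (Mathlib: `Smooth ⇒ Flat`), and proper, hence SEPARATED, so a morphism `f : W ⟶ 𝒜.X` of
`T`-schemes with `W` PROPER over `Spec T` has `f.left` universally closed (`UniversallyClosed.of_comp_of_isSeparated`).
Consequently (`AbelianScheme.surjective_left_of_surjective_pullback_map_left`) such an `f` is surjective as soon as ONE
base change `f ×_{Spec T} S'` along a map `S' ⟶ Spec T` whose image generises `Spec T` is — e.g.
(`…_of_injective`) along `Spec K ⟶ Spec T` for an injective `T → K` into a field, `T` a domain — and then EVERY base
change of `f` is surjective (`Limits.surjective_pullback_map_left`).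

Use (cell `hodgecm-mathlib`, III-0 road F5, A-p14): `f = pmSumGrp F n₀` on `W = X_{T″}^{⊗(2n₀+2)}` (proper over
`Spec T″`) into the spread `𝒜_{T″}`, `K = ℂ`.  Nothing beyond EGA IV₂ 2.3.4 is asserted.

## References
* [EGAIV2] A. Grothendieck, J. Dieudonné, EGA IV₂ (1965), Prop. 2.3.4, Cor. 2.3.5.
* [MumfordFogartyKirwan1994] D. Mumford, J. Fogarty, F. Kirwan, *Geometric Invariant Theory*, 3rd ed., Ch. 6 §1 Def. 6.1
  (abelian schemes: proper smooth group schemes with connected geometric fibres).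
-/

set_option autoImplicit false

noncomputable section

universe u

open CategoryTheory CategoryTheory.Limits AlgebraicGeometry TopologicalSpace Topology
open Literature.AlgebraicGeometry.Limits

namespace Literature.AlgebraicGeometry.AbelianSchemes

/-- a morphism of `S`-schemes from a PROPER `S`-scheme to a SEPARATED `S`-scheme is universally closed on underlying
schemes (`f.left ≫ Y.hom = W.hom` is universally closed, cancel the separated `Y.hom`). [cite: EGAIV2, Cor. 2.3.5] -/
theorem universallyClosed_left_of_isProper {S : Scheme.{u}} {W Y : Over S} (f : W ⟶ Y) [IsProper W.hom]
    [IsSeparated Y.hom] : UniversallyClosed f.left := by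
  haveI : UniversallyClosed (f.left ≫ Y.hom) := by rw [Over.w f]; infer_instance
  exact UniversallyClosed.of_comp_of_isSeparated f.left Y.hom

namespace AbelianScheme

variable {T : Type u} [CommRing T] (𝒜 : AbelianScheme T)

/-- the structure morphism of an abelian scheme is flat (it is smooth). [cite: MumfordFogartyKirwan1994, Ch. 6 §1 Definition 6.1 (p. 115)] -/
theorem flat_hom : Flat 𝒜.X.hom := by
  haveI := 𝒜.isSmooth
  infer_instance

/-- the structure morphism of an abelian scheme is separated (it is proper).
[cite: MumfordFogartyKirwan1994, Ch. 6 §1 Definition 6.1 (p. 115)] -/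
theorem isSeparated_hom : IsSeparated 𝒜.X.hom := by
  haveI := 𝒜.isProper
  infer_instance

/-- a `T`-morphism from a proper `T`-scheme into an abelian scheme is universally closed on underlying schemes.
[cite: EGAIV2, Cor. 2.3.5] -/
theorem universallyClosed_left {W : Motives.SchemeOver T} [IsProper W.hom] (f : W ⟶ 𝒜.X) :
    UniversallyClosed f.left := by
  haveI := 𝒜.isSeparated_hom
  exact universallyClosed_left_of_isProper f

/-- **F4′.  SURJECTIVITY ONTO AN ABELIAN SCHEME SPREADS FROM A GENERISING BASE CHANGE.**  `𝒜` an abelian scheme over `T`,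
`W` a PROPER `T`-scheme, `f : W ⟶ 𝒜.X` a `T`-morphism, `g : S' ⟶ Spec T` a map whose image generises every point of
`Spec T`; if the base change `(Over.pullback g).map f` is surjective then `f.left` is surjective.
[cite: EGAIV2, Prop. 2.3.4, Cor. 2.3.5] [cite: StacksProject, Tag 03HV] -/
theorem surjective_left_of_surjective_pullback_map_left {W : Motives.SchemeOver T} [IsProper W.hom] (f : W ⟶ 𝒜.X)
    {S' : Scheme.{u}} (g : S' ⟶ Spec (.of T)) (hg : ∀ s : Spec (.of T), ∃ s' : S', g.base s' ⤳ s)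
    [Surjective ((Over.pullback g).map f).left] : Surjective f.left := by
  haveI := 𝒜.flat_hom
  haveI := 𝒜.universallyClosed_left f
  exact Limits.surjective_left_of_surjective_pullback_map_left g f hg

/-- **F4′, affine-domain form.**  `T` a domain, `ψ : T → K` an injective ring map into a field (e.g. a finitely generated
subring `T ⊆ ℂ` with its inclusion), `𝒜` an abelian scheme over `T`, `W` a proper `T`-scheme, `f : W ⟶ 𝒜.X`: if the base
change of `f` along `Spec K ⟶ Spec T` is surjective then `f.left` is surjective — and hence so is every base change of
`f` (`Limits.surjective_pullback_map_left`), in particular every fibre over `Spec T`.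
[cite: EGAIV2, Prop. 2.3.4, Cor. 2.3.5] [cite: StacksProject, Tag 03HV] -/
theorem surjective_left_of_surjective_pullback_map_left_of_injective [IsDomain T] {K : Type u} [Field K]
    (ψ : T →+* K) (hψ : Function.Injective ψ) {W : Motives.SchemeOver T} [IsProper W.hom] (f : W ⟶ 𝒜.X)
    [Surjective ((Over.pullback (specMap ψ)).map f).left] : Surjective f.left :=
  𝒜.surjective_left_of_surjective_pullback_map_left f (specMap ψ) (forall_exists_specializes_of_injective ψ hψ)

/-- … and then every base change of `f` is surjective (in particular every fibre `f_s` over a point `s` of `Spec T`,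
realised as `(Over.pullback (specMap φ)).map f` for `φ : T → κ(s)`). [cite: EGAIV2, Cor. 2.3.5] -/
theorem surjective_pullback_map_left_of_injective [IsDomain T] {K : Type u} [Field K]
    (ψ : T →+* K) (hψ : Function.Injective ψ) {W : Motives.SchemeOver T} [IsProper W.hom] (f : W ⟶ 𝒜.X)
    [Surjective ((Over.pullback (specMap ψ)).map f).left] {S' : Scheme.{u}} (i : S' ⟶ Spec (.of T)) :
    Surjective ((Over.pullback i).map f).left := by
  haveI := 𝒜.surjective_left_of_surjective_pullback_map_left_of_injective ψ hψ f
  exact Limits.surjective_pullback_map_left i f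

end AbelianScheme

end Literature.AlgebraicGeometry.AbelianSchemes

end
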